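import Summits.KontsevichZagierPeriods.KontsevichZagierPeriods.Theorems.SoloInformedHypSubstTwo
import HarnessLib
import HarnessLib.Audit

/-!
# SoloInformed — the period conjecture for integrands in `K(x, √(1 − x²))`, `K(x, √(1 + x²))`, `K(x, √(x² − 1))`

Solo programme `solo-KontsevichZagierPeriods-informed`, session s112, file 29.

Files 25–27 describe the three genus-`0` quadratic-radical classes through the uniformising
parameter `τ` (`x` and the radical are rational in `τ`).  Here the classes are presented the way one
writes them: integrand `(A(x) + B(x)·√(q(x)))/C(x)` with `A, B, C ∈ K[X]` (`K` = real algebraic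
numbers), `C(x) ≠ 0` on the domain, for `q = 1 − x²` (`D ⊆ (−1, 1]`), `q = 1 + x²` (any `D`) and
`q = x² − 1` (`D ⊆ [1, ∞)`).  The algebra is one lemma (`soloInformed_exists_aeval_div_pow`:
`A(U(τ)/V(τ)) = N(τ)/V(τ)^{deg A}` for an explicit `N ∈ K[X]`) and one assembly
(`soloInformed_exists_PQ_of_sqrt_rational`).  Consequently (`soloInformed_kzp_quadraticRadical`):
**any two absolutely convergent one-variable integrals whose integrands lie in `K(x, √(1 − x²))`,
`K(x, √(1 + x²))` or `K(x, √(x² − 1))` (each on an admissible domain, in any combination) and whose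
values agree are equivalent under the Kontsevich–Zagier rules** — unconditionally; e.g.
`π = 2∫_{−1}^{1} √(1 − x²) dx = ∫_{−1}^{1} dx/√(1 − x²)` (file 28), `log(1 + √2) = ∫₀¹ dx/√(1 + x²)`.

References: M. Kontsevich, D. Zagier, *Periods* (2001), §1.1–1.2; A. Baker (1975), Thm. 2.1.
-/

noncomputable section

open scoped BigOperators Polynomial

namespace Summit.KontsevichZagierPeriods.KontsevichZagierPeriods.Theorems

open Set MeasureTheory
open Literature.ModelTheory.ExponentialFields
open Literature.NumberTheory.Transcendental Literature.NumberTheory.Transcendental.KZ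

/-! ## Algebra: composing a polynomial with a fraction -/

/-- `A(U(τ)/V(τ)) · V(τ)^{deg A}` is a polynomial in `τ` (explicitly `Σ aᵢ Uⁱ V^{deg A − i}`). -/
theorem soloInformed_exists_aeval_div_pow (A U V : (algebraicClosure ℚ ℝ)[X]) :
    ∃ N : (algebraicClosure ℚ ℝ)[X], ∀ t : ℝ, (Polynomial.aeval t V : ℝ) ≠ 0 →
      (Polynomial.aeval ((Polynomial.aeval t U : ℝ) / Polynomial.aeval t V) A : ℝ) =
        Polynomial.aeval t N / (Polynomial.aeval t V) ^ A.natDegree := by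
  refine ⟨∑ i ∈ Finset.range (A.natDegree + 1),
    Polynomial.C (A.coeff i) * U ^ i * V ^ (A.natDegree - i), fun t hV => ?_⟩
  rw [Polynomial.aeval_eq_sum_range, eq_div_iff (pow_ne_zero _ hV), Finset.sum_mul, map_sum]
  refine Finset.sum_congr rfl fun i hi => ?_
  have hi' : i ≤ A.natDegree := Nat.lt_succ_iff.mp (Finset.mem_range.mp hi)
  have hv : (Polynomial.aeval t V : ℝ) ^ A.natDegree =
      (Polynomial.aeval t V : ℝ) ^ i * (Polynomial.aeval t V) ^ (A.natDegree - i) := by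
    rw [← pow_add, Nat.add_sub_cancel' hi']
  rw [map_mul, map_mul, map_pow, map_pow, Polynomial.aeval_C, Algebra.smul_def, div_pow, hv]
  have hVi : (Polynomial.aeval t V : ℝ) ^ i ≠ 0 := pow_ne_zero _ hV
  field_simp

/-- Assembly: `(A(x) + B(x)·s)/C(x)` with `x = U(τ)/V(τ)`, `s = S(τ)/V(τ)` is `P(τ)/Q(τ)` for explicit
`P, Q ∈ K[X]`, with `Q(τ) ≠ 0` wherever `V(τ) ≠ 0` and `C(x) ≠ 0`. -/
theorem soloInformed_exists_PQ_of_sqrt_rational (A B C U S V : (algebraicClosure ℚ ℝ)[X]) :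
    ∃ P Q : (algebraicClosure ℚ ℝ)[X], ∀ t : ℝ, (Polynomial.aeval t V : ℝ) ≠ 0 →
      (Polynomial.aeval ((Polynomial.aeval t U : ℝ) / Polynomial.aeval t V) C : ℝ) ≠ 0 →
      (Polynomial.aeval t Q : ℝ) ≠ 0 ∧
      ((Polynomial.aeval ((Polynomial.aeval t U : ℝ) / Polynomial.aeval t V) A : ℝ) +
          Polynomial.aeval ((Polynomial.aeval t U : ℝ) / Polynomial.aeval t V) B *
            ((Polynomial.aeval t S : ℝ) / Polynomial.aeval t V)) /
        Polynomial.aeval ((Polynomial.aeval t U : ℝ) / Polynomial.aeval t V) C =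
      Polynomial.aeval t P / Polynomial.aeval t Q := by
  obtain ⟨NA, hNA⟩ := soloInformed_exists_aeval_div_pow A U V
  obtain ⟨NB, hNB⟩ := soloInformed_exists_aeval_div_pow B U V
  obtain ⟨NC, hNC⟩ := soloInformed_exists_aeval_div_pow C U V
  refine ⟨(NA * V ^ (B.natDegree + 1) + NB * S * V ^ A.natDegree) * V ^ C.natDegree,
    NC * V ^ (A.natDegree + B.natDegree + 1), fun t hV hC => ?_⟩
  rw [hNC t hV] at hC
  have hNC0 : (Polynomial.aeval t NC : ℝ) ≠ 0 := (div_ne_zero_iff.mp hC).1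
  refine ⟨by rw [map_mul, map_pow]; exact mul_ne_zero hNC0 (pow_ne_zero _ hV), ?_⟩
  rw [hNA t hV, hNB t hV, hNC t hV]
  simp only [map_mul, map_add, map_pow]
  field_simp
  ring

/-! ## The three classes in the form `(A(x) + B(x)√q(x))/C(x)` -/

/-- `x = (1 − τ²)/(1 + τ²)` for `τ = √((1 − x)/(1 + x))`, `−1 < x ≤ 1`. -/
theorem soloInformed_eq_circ_frac {x : ℝ} (hx1 : -1 < x) (hx2 : x ≤ 1) :
    (Polynomial.aeval (soloInformedCircInv x) (1 + Polynomial.X ^ 2 : (algebraicClosure ℚ ℝ)[X]) : ℝ) ≠ 0 ∧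
    x = (Polynomial.aeval (soloInformedCircInv x) (1 - Polynomial.X ^ 2 : (algebraicClosure ℚ ℝ)[X]) : ℝ) /
      Polynomial.aeval (soloInformedCircInv x) (1 + Polynomial.X ^ 2 : (algebraicClosure ℚ ℝ)[X]) ∧
    Real.sqrt (1 - x ^ 2) =
      (Polynomial.aeval (soloInformedCircInv x) (Polynomial.C (2 : algebraicClosure ℚ ℝ) * Polynomial.X) : ℝ) /
        Polynomial.aeval (soloInformedCircInv x) (1 + Polynomial.X ^ 2 : (algebraicClosure ℚ ℝ)[X]) := by
  obtain ⟨-, -, h3⟩ := soloInformed_circMap_circInv hx1 hx2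
  simp only [map_add, map_one, map_pow, map_sub, map_mul, Polynomial.aeval_X, map_ofNat]
  refine ⟨by positivity, ?_, ?_⟩
  · rw [pow_two]; exact h3.symm
  · rw [soloInformed_sqrt_one_sub_sq hx1 hx2, pow_two]

/-- `x = (τ² − 1)/(2τ)` and `√(1 + x²) = (τ² + 1)/(2τ)` for `τ = x + √(1 + x²)`. -/
theorem soloInformed_eq_hyp_frac (x : ℝ) :
    (Polynomial.aeval (soloInformedHypInv x) (Polynomial.C (2 : algebraicClosure ℚ ℝ) * Polynomial.X) : ℝ) ≠ 0 ∧
    x = (Polynomial.aeval (soloInformedHypInv x) (Polynomial.X ^ 2 - 1 : (algebraicClosure ℚ ℝ)[X]) : ℝ) /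
      Polynomial.aeval (soloInformedHypInv x) (Polynomial.C (2 : algebraicClosure ℚ ℝ) * Polynomial.X) ∧
    Real.sqrt (1 + x ^ 2) =
      (Polynomial.aeval (soloInformedHypInv x) (Polynomial.X ^ 2 + 1 : (algebraicClosure ℚ ℝ)[X]) : ℝ) /
        Polynomial.aeval (soloInformedHypInv x) (Polynomial.C (2 : algebraicClosure ℚ ℝ) * Polynomial.X) := by
  obtain ⟨hpos, hx⟩ := soloInformed_hypMap_hypInv x
  simp only [map_add, map_one, map_pow, map_sub, map_mul, Polynomial.aeval_X, map_ofNat]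
  have h1 : soloInformedHypInv x * soloInformedHypInv x - 1 = x * (2 * soloInformedHypInv x) :=
    (div_eq_iff (by positivity)).1 hx
  have h2 : Real.sqrt (1 + x ^ 2) = soloInformedHypInv x - x := by
    show Real.sqrt (1 + x ^ 2) = x + Real.sqrt (1 + x ^ 2) - x
    ring
  refine ⟨by positivity, ?_, ?_⟩
  · rw [pow_two]; exact hx.symm
  · rw [h2, eq_div_iff (by positivity)]
    linear_combination h1

/-- `x = (τ² + 1)/(2τ)` and `√(x² − 1) = (τ² − 1)/(2τ)` for `τ = x + √(x² − 1)`, `x ≥ 1`. -/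
theorem soloInformed_eq_hypTwo_frac {x : ℝ} (hx1 : 1 ≤ x) :
    (Polynomial.aeval (soloInformedHypTwoInv x) (Polynomial.C (2 : algebraicClosure ℚ ℝ) * Polynomial.X) : ℝ) ≠ 0 ∧
    x = (Polynomial.aeval (soloInformedHypTwoInv x) (Polynomial.X ^ 2 + 1 : (algebraicClosure ℚ ℝ)[X]) : ℝ) /
      Polynomial.aeval (soloInformedHypTwoInv x) (Polynomial.C (2 : algebraicClosure ℚ ℝ) * Polynomial.X) ∧
    Real.sqrt (x ^ 2 - 1) =
      (Polynomial.aeval (soloInformedHypTwoInv x) (Polynomial.X ^ 2 - 1 : (algebraicClosure ℚ ℝ)[X]) : ℝ) /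
        Polynomial.aeval (soloInformedHypTwoInv x) (Polynomial.C (2 : algebraicClosure ℚ ℝ) * Polynomial.X) := by
  obtain ⟨hge, hx⟩ := soloInformed_hypTwoMap_hypTwoInv hx1
  simp only [map_add, map_one, map_pow, map_sub, map_mul, Polynomial.aeval_X, map_ofNat]
  have h1 : soloInformedHypTwoInv x * soloInformedHypTwoInv x + 1 = x * (2 * soloInformedHypTwoInv x) :=
    (div_eq_iff (by positivity)).1 hx
  have h2 : Real.sqrt (x ^ 2 - 1) = soloInformedHypTwoInv x - x := by
    show Real.sqrt (x ^ 2 - 1) = x + Real.sqrt (x ^ 2 - 1) - x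
    ring
  refine ⟨by positivity, ?_, ?_⟩
  · rw [pow_two]; exact hx.symm
  · rw [h2, eq_div_iff (by positivity)]
    linear_combination h1

/-- **`K(x, √(1 − x²))`:** integrand `(A(x) + B(x)√(1 − x²))/C(x)` on `D ⊆ (−1, 1]` with `C ≠ 0` on `D`
⇒ the circle class of file 25. -/
theorem soloInformed_isKCircleOne_of_sqrt_rational (r : IntegralRep 1) (A B C : (algebraicClosure ℚ ℝ)[X])
    (hD : ∀ x ∈ r.domain, -1 < x 0 ∧ x 0 ≤ 1 ∧ (Polynomial.aeval (x 0) C : ℝ) ≠ 0)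
    (hf : EqOn r.integrand (fun x => ((Polynomial.aeval (x 0) A : ℝ) +
      Polynomial.aeval (x 0) B * Real.sqrt (1 - x 0 ^ 2)) / Polynomial.aeval (x 0) C) r.domain) :
    SoloInformedIsKCircleOne r := by
  obtain ⟨P, Q, hPQ⟩ := soloInformed_exists_PQ_of_sqrt_rational A B C (1 - Polynomial.X ^ 2)
    (Polynomial.C (2 : algebraicClosure ℚ ℝ) * Polynomial.X) (1 + Polynomial.X ^ 2)
  refine ⟨P, Q, fun x hx => ?_, fun x hx => ?_⟩
  · obtain ⟨h1, h2, hC⟩ := hD x hx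
    obtain ⟨hV, hxe, -⟩ := soloInformed_eq_circ_frac (x := x 0) h1 h2
    rw [hxe] at hC
    exact ⟨h1, h2, (hPQ _ hV hC).1⟩
  · obtain ⟨h1, h2, hC⟩ := hD x hx
    obtain ⟨hV, hxe, hs⟩ := soloInformed_eq_circ_frac (x := x 0) h1 h2
    rw [hf hx]
    set τ := soloInformedCircInv (x 0) with hτ
    show ((Polynomial.aeval (x 0) A : ℝ) + Polynomial.aeval (x 0) B * Real.sqrt (1 - x 0 ^ 2)) /
        Polynomial.aeval (x 0) C = Polynomial.aeval τ P / Polynomial.aeval τ Q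
    rw [hxe] at hC
    rw [hs, hxe]
    exact (hPQ τ hV hC).2

/-- **`K(x, √(1 + x²))`:** integrand `(A(x) + B(x)√(1 + x²))/C(x)` on any `D` with `C ≠ 0` on `D`
⇒ the class of file 26. -/
theorem soloInformed_isKHypOne_of_sqrt_rational (r : IntegralRep 1) (A B C : (algebraicClosure ℚ ℝ)[X])
    (hD : ∀ x ∈ r.domain, (Polynomial.aeval (x 0) C : ℝ) ≠ 0)
    (hf : EqOn r.integrand (fun x => ((Polynomial.aeval (x 0) A : ℝ) +
      Polynomial.aeval (x 0) B * Real.sqrt (1 + x 0 ^ 2)) / Polynomial.aeval (x 0) C) r.domain) :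
    SoloInformedIsKHypOne r := by
  obtain ⟨P, Q, hPQ⟩ := soloInformed_exists_PQ_of_sqrt_rational A B C (Polynomial.X ^ 2 - 1)
    (Polynomial.X ^ 2 + 1) (Polynomial.C (2 : algebraicClosure ℚ ℝ) * Polynomial.X)
  refine ⟨P, Q, fun x hx => ?_, fun x hx => ?_⟩
  · have hC := hD x hx
    obtain ⟨hV, hxe, -⟩ := soloInformed_eq_hyp_frac (x 0)
    rw [hxe] at hC
    exact (hPQ _ hV hC).1
  · have hC := hD x hx
    obtain ⟨hV, hxe, hs⟩ := soloInformed_eq_hyp_frac (x 0)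
    rw [hf hx]
    set τ := soloInformedHypInv (x 0) with hτ
    show ((Polynomial.aeval (x 0) A : ℝ) + Polynomial.aeval (x 0) B * Real.sqrt (1 + x 0 ^ 2)) /
        Polynomial.aeval (x 0) C = Polynomial.aeval τ P / Polynomial.aeval τ Q
    rw [hxe] at hC
    rw [hs, hxe]
    exact (hPQ τ hV hC).2

/-- **`K(x, √(x² − 1))`:** integrand `(A(x) + B(x)√(x² − 1))/C(x)` on `D ⊆ [1, ∞)` with `C ≠ 0` on `D`
⇒ the class of file 27. -/
theorem soloInformed_isKHypTwoOne_of_sqrt_rational (r : IntegralRep 1)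
    (A B C : (algebraicClosure ℚ ℝ)[X])
    (hD : ∀ x ∈ r.domain, 1 ≤ x 0 ∧ (Polynomial.aeval (x 0) C : ℝ) ≠ 0)
    (hf : EqOn r.integrand (fun x => ((Polynomial.aeval (x 0) A : ℝ) +
      Polynomial.aeval (x 0) B * Real.sqrt (x 0 ^ 2 - 1)) / Polynomial.aeval (x 0) C) r.domain) :
    SoloInformedIsKHypTwoOne r := by
  obtain ⟨P, Q, hPQ⟩ := soloInformed_exists_PQ_of_sqrt_rational A B C (Polynomial.X ^ 2 + 1)
    (Polynomial.X ^ 2 - 1) (Polynomial.C (2 : algebraicClosure ℚ ℝ) * Polynomial.X)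
  refine ⟨P, Q, fun x hx => ?_, fun x hx => ?_⟩
  · obtain ⟨h1, hC⟩ := hD x hx
    obtain ⟨hV, hxe, -⟩ := soloInformed_eq_hypTwo_frac (x := x 0) h1
    rw [hxe] at hC
    exact ⟨h1, (hPQ _ hV hC).1⟩
  · obtain ⟨h1, hC⟩ := hD x hx
    obtain ⟨hV, hxe, hs⟩ := soloInformed_eq_hypTwo_frac (x := x 0) h1
    rw [hf hx]
    set τ := soloInformedHypTwoInv (x 0) with hτ
    show ((Polynomial.aeval (x 0) A : ℝ) + Polynomial.aeval (x 0) B * Real.sqrt (x 0 ^ 2 - 1)) /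
        Polynomial.aeval (x 0) C = Polynomial.aeval τ P / Polynomial.aeval τ Q
    rw [hxe] at hC
    rw [hs, hxe]
    exact (hPQ τ hV hC).2

/-! ## The period conjecture across the three quadratic-radical classes -/

/-- `r` (dimension `1`) is in one of the three genus-`0` quadratic-radical classes. -/
def SoloInformedIsKQuadRadicalOne (r : IntegralRep 1) : Prop :=
  SoloInformedIsKCircleOne r ∨ SoloInformedIsKHypOne r ∨ SoloInformedIsKHypTwoOne r

/-- Members of the three classes lie in the span of points and segments. -/
theorem soloInformed_segSpan_of_isKQuadRadicalOne (r : IntegralRep 1)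
    (hr : SoloInformedIsKQuadRadicalOne r) : of r ∈ soloInformedSegSpan := by
  rcases hr with h | h | h
  · exact soloInformed_segSpan_of_isKCircleOne r h
  · exact soloInformed_segSpan_of_isKHypOne r h
  · exact soloInformed_segSpan_of_isKHypTwoOne r h

/-- **The Kontsevich–Zagier period conjecture for one-variable integrands in `K(x, √(1 − x²))`,
`K(x, √(1 + x²))`, `K(x, √(x² − 1))`** (real algebraic coefficients; domains `⊆ (−1,1]`, arbitrary,
`⊆ [1,∞)` respectively; any combination of the classes), and against the `K`-rational class and
rational representations of dimension `≤ 1`: equal values ⇒ KZ-equivalent.  Unconditional.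
[Kontsevich–Zagier 2001, §1.2 Question 1; this work] -/
theorem soloInformed_kzp_quadraticRadical (r r' : IntegralRep 1) (hr : SoloInformedIsKQuadRadicalOne r)
    (hr' : SoloInformedIsKQuadRadicalOne r') :
    (r.value = r'.value → Equivalent r r') ∧
    (∀ r₁ : IntegralRep 1, SoloInformedIsKRationalOne r₁ → r.value = r₁.value → Equivalent r r₁) ∧
    (∀ {n : ℕ} (hn : n ≤ 1) (r₀ : IntegralRep n), r₀.IsRational → r.value = r₀.value →
      Equivalent r r₀) := by
  have h := soloInformed_segSpan_of_isKQuadRadicalOne r hr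
  exact ⟨fun hv => soloInformed_equivalent_of_mem_segSpan h
      (soloInformed_segSpan_of_isKQuadRadicalOne r' hr') hv,
    fun r₁ hr₁ hv => soloInformed_equivalent_of_mem_segSpan h
      (soloInformed_segSpan_of_isKRationalOne r₁ hr₁) hv,
    fun hn r₀ hr₀ hv => soloInformed_equivalent_of_mem_segSpan h
      (soloInformed_of_mem_segSpan_of_isRational hn r₀ hr₀) hv⟩

/-- A value-zero member gives a relation: `[r] ∈ relations`. -/
theorem soloInformed_mem_relations_of_value_eq_zero_quadraticRadical (r : IntegralRep 1)
    (hr : SoloInformedIsKQuadRadicalOne r) (h0 : r.value = 0) : of r ∈ relations :=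
  soloInformed_mem_relations_of_mem_segSpan (soloInformed_segSpan_of_isKQuadRadicalOne r hr)
    (by rw [eval_of]; exact h0)

end Summit.KontsevichZagierPeriods.KontsevichZagierPeriods.Theorems
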